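import Literature.Geometry.Lorentzian.CoordConstraintAdjoint
import Literature.Geometry.Lorentzian.CoordMomentumConstraintVariation
import Literature.Geometry.Lorentzian.CoordTensorCovariance
import HarnessLib

/-!
# Locality of the coordinate constraint operators and of their adjoints

The coordinate constraint map `(G, K) ↦ (H, M)` (`hamAt`, `momFn`) and the formal adjoint of its
linearisation `(N, Y) ↦ (DH*_γ + DM*ˢ_γ, DH*_κ + DM*ˢ_κ)` (`adjHamG`, `adjHamK`, `adjMomGS`,
`adjMomKS`, `CoordConstraintAdjoint.lean`) are **differential operators**: their value at `x` only
depends on the germs of `(G, K, N, Y)` at `x`. This file records the corresponding congruence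
lemmas under eventual equality `G =ᶠ[𝓝 x] G'`, `K =ᶠ[𝓝 x] K'`, `N =ᶠ[𝓝 x] N'`, `Y =ᶠ[𝓝 x] Y'`
(`hamAt_congr`, `momFn_congr`, `adjHamG_congr`, `adjHamK_congr`, `adjMomGS_congr`,
`adjMomKS_congr`), through the locality of their building blocks (`sharpAt`, `mtrAt`, `chrAt`,
`ricAt`, `hessAt`, `covDAt`, `divAt`, `cov₂At`). They transfer the KID equations and the vacuum
constraints between two coordinate descriptions of the same data which agree on an open set
(the chart readings `coordHOn`, `coordKOn` and the slice data `sliceMetric`, `sliceK` of a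
Gaussian chart, `DevelopmentGaussianChart.lean`). Everything is proved; no definitions, no named
facts.

## References

* P. T. Chruściel, E. Delay, Mém. Soc. Math. Fr. 94 (2003), §2 (the operator `P*`).
  [ChruscielDelay2003]
* R. Bartnik, J. Isenberg, *The constraint equations* (2004), (2.1)–(2.2). [BartnikIsenberg2004]
-/

noncomputable section

open Set Function Filter
open scoped Topology ContDiff

namespace Literature.Geometry.Lorentzian

namespace MetricCoord

variable {E : Type*} [NormedAddCommGroup E] [NormedSpace ℝ E] [FiniteDimensional ℝ E]
  {G G' K K' : E → E →L[ℝ] E →L[ℝ] ℝ} {N N' : E → ℝ} {X X' : E → E} {x : E}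

/-! ### Building blocks -/

omit [FiniteDimensional ℝ E] in
/-- `♯` at `x` only depends on `G x`. [folklore] -/
theorem sharpAt_congr_of_eventuallyEq (hG : G =ᶠ[𝓝 x] G') : sharpAt G x = sharpAt G' x := by
  rw [sharpAt, sharpAt, hG.eq_of_nhds]

omit [FiniteDimensional ℝ E] in
/-- The metric trace at `x` only depends on `G x`. [folklore] -/
theorem mtrAt_congr_of_eventuallyEq (hG : G =ᶠ[𝓝 x] G') (β : E →L[ℝ] E →L[ℝ] ℝ) :
    mtrAt G x β = mtrAt G' x β := by
  rw [mtrAt, mtrAt, sharpAt_congr_of_eventuallyEq hG]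

omit [FiniteDimensional ℝ E] in
/-- The metric square norm at `x` only depends on `G x`. [folklore] -/
theorem normSqAt_congr_of_eventuallyEq (hG : G =ᶠ[𝓝 x] G') (β : E →L[ℝ] E →L[ℝ] ℝ) :
    normSqAt G x β = normSqAt G' x β := by
  rw [normSqAt, normSqAt, sharpAt_congr_of_eventuallyEq hG]

omit [NormedSpace ℝ E] [FiniteDimensional ℝ E] in
/-- An eventual equality holds on an open set around the point. [folklore] -/
theorem exists_isOpen_eqOn_of_eventuallyEq {α : Type*} {f g : E → α} (h : f =ᶠ[𝓝 x] g) :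
    ∃ U : Set E, IsOpen U ∧ x ∈ U ∧ ∀ y ∈ U, f y = g y := by
  obtain ⟨U, hU, hUo, hxU⟩ := mem_nhds_iff.1 h
  exact ⟨U, hUo, hxU, fun y hy ↦ hU hy⟩

/-- The Ricci form at `x` only depends on the germ of `G` at `x`. [folklore] -/
theorem ricAt_congr_of_eventuallyEq (hG : G =ᶠ[𝓝 x] G') :
    ricAt G x = ricAt G' x := by
  obtain ⟨U, hU, hxU, h⟩ := exists_isOpen_eqOn_of_eventuallyEq hG
  ext Y Z
  rw [ricAt_apply, ricAt_apply]
  congr 1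
  ext W
  simp [riemAt_congr_of_eqOn hU h hxU]

/-- The scalar curvature at `x` only depends on the germ of `G` at `x`. [folklore] -/
theorem scalAt_congr_of_eventuallyEq (hG : G =ᶠ[𝓝 x] G') :
    scalAt G x = scalAt G' x := by
  rw [scalAt, scalAt, ricAt_congr_of_eventuallyEq hG, mtrAt_congr_of_eventuallyEq hG]

omit [FiniteDimensional ℝ E] in
/-- The Hessian at `x` only depends on the germs of `G` and `f`. [folklore] -/
theorem hessAt_congr_of_eventuallyEq₂ (hG : G =ᶠ[𝓝 x] G') (hN : N =ᶠ[𝓝 x] N') :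
    hessAt G N x = hessAt G' N' x := by
  rw [hessAt, hessAt, hN.fderiv.fderiv_eq, hN.fderiv_eq, chrAt_congr_of_eventuallyEq hG]

/-- The Laplacian at `x` only depends on the germs of `G` and `f`. [folklore] -/
theorem lapAt_congr_of_eventuallyEq₂ (hG : G =ᶠ[𝓝 x] G')
    (hN : N =ᶠ[𝓝 x] N') : lapAt G N x = lapAt G' N' x := by
  rw [lapAt, lapAt, hessAt_congr_of_eventuallyEq₂ hG hN, mtrAt_congr_of_eventuallyEq hG]

/-- `DS*_G(f)` at `x` only depends on the germs of `G` and `f`. [folklore] -/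
theorem adjScalAt_congr_of_eventuallyEq (hG : G =ᶠ[𝓝 x] G')
    (hN : N =ᶠ[𝓝 x] N') : adjScalAt G N x = adjScalAt G' N' x := by
  rw [adjScalAt, adjScalAt, lapAt_congr_of_eventuallyEq₂ hG hN, hessAt_congr_of_eventuallyEq₂ hG hN,
    ricAt_congr_of_eventuallyEq hG, hG.eq_of_nhds, hN.eq_of_nhds]

omit [FiniteDimensional ℝ E] in
/-- `∇Z` at `x` only depends on the germs of `G` and `Z`. [folklore] -/
theorem covDAt_congr_of_eventuallyEq₂ (hG : G =ᶠ[𝓝 x] G') (hX : X =ᶠ[𝓝 x] X') :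
    covDAt G X x = covDAt G' X' x := by
  rw [covDAt, covDAt, hX.fderiv_eq, hX.eq_of_nhds, chrAt_congr_of_eventuallyEq hG]

/-- `div Z` at `x` only depends on the germs of `G` and `Z`. [folklore] -/
theorem divAt_congr_of_eventuallyEq₂ (hG : G =ᶠ[𝓝 x] G') (hX : X =ᶠ[𝓝 x] X') :
    divAt G X x = divAt G' X' x := by
  rw [divAt_eq, divAt_eq, covDAt_congr_of_eventuallyEq₂ hG hX]

omit [FiniteDimensional ℝ E] in
/-- `∇K` at `x` only depends on the germs of `G` and `K`. [folklore] -/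
theorem cov₂At_congr_of_eventuallyEq (hG : G =ᶠ[𝓝 x] G') (hK : K =ᶠ[𝓝 x] K') :
    cov₂At G K x = cov₂At G' K' x := by
  rw [cov₂At, cov₂At, hK.fderiv_eq, hK.eq_of_nhds, chrAt_congr_of_eventuallyEq hG]

/-! ### The constraint operators -/

/-- **The Hamiltonian constraint density is local.** [cite: BartnikIsenberg2004, (2.1)] -/
theorem hamAt_congr_of_eventuallyEq (hG : G =ᶠ[𝓝 x] G')
    (hK : K =ᶠ[𝓝 x] K') : hamAt G K x = hamAt G' K' x := by
  rw [hamAt_eq, hamAt_eq, scalAt_congr_of_eventuallyEq hG, normSqAt_congr_of_eventuallyEq hG,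
    mtrAt_congr_of_eventuallyEq hG, hK.eq_of_nhds]

/-- **The momentum constraint covector is local.** [cite: BartnikIsenberg2004, (2.2)] -/
theorem momFn_congr_of_eventuallyEq {ι : Type*} [Fintype ι]
    (b : Module.Basis ι ℝ E) (hG : G =ᶠ[𝓝 x] G') (hK : K =ᶠ[𝓝 x] K') (Z : E) :
    momFn b G K x Z = momFn b G' K' x Z := by
  have hginv : ∀ k l, ginv G b x k l = ginv G' b x k l := fun k l ↦ by
    rw [ginv, ginv, sharpAt_congr_of_eventuallyEq hG]
  have htr : (fun y ↦ mtrAt G y (K y)) =ᶠ[𝓝 x] fun y ↦ mtrAt G' y (K' y) := by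
    filter_upwards [hG.eventuallyEq_nhds, hK] with y hGy hKy
    rw [mtrAt_congr_of_eventuallyEq hGy, hKy]
  rw [momFn_eq, momFn_eq, htr.fderiv_eq, cov₂At_congr_of_eventuallyEq hG hK]
  simp only [hginv]

/-! ### The adjoint of the linearised constraint map -/

/-- **`DH*_γ(N)` is local.** [cite: ChruscielDelay2003, §2] -/
theorem adjHamG_congr_of_eventuallyEq (hG : G =ᶠ[𝓝 x] G')
    (hK : K =ᶠ[𝓝 x] K') (hN : N =ᶠ[𝓝 x] N') : adjHamG G K N x = adjHamG G' K' N' x := by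
  rw [adjHamG, adjHamG, adjScalAt_congr_of_eventuallyEq hG hN, hN.eq_of_nhds, hK.eq_of_nhds,
    sharpAt_congr_of_eventuallyEq hG, mtrAt_congr_of_eventuallyEq hG]

omit [FiniteDimensional ℝ E] in
/-- **`DH*_κ(N)` is local** (indeed pointwise). [cite: ChruscielDelay2003, §2] -/
theorem adjHamK_congr_of_eventuallyEq (hG : G =ᶠ[𝓝 x] G') (hK : K =ᶠ[𝓝 x] K')
    (hN : N =ᶠ[𝓝 x] N') : adjHamK G K N x = adjHamK G' K' N' x := by
  rw [adjHamK, adjHamK, hN.eq_of_nhds, hK.eq_of_nhds, hG.eq_of_nhds, mtrAt_congr_of_eventuallyEq hG]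

/-- **`DM*ˢ_κ(X)` is local.** [cite: ChruscielDelay2003, §2] -/
theorem adjMomKS_congr_of_eventuallyEq (hG : G =ᶠ[𝓝 x] G') (hX : X =ᶠ[𝓝 x] X') :
    adjMomKS G X x = adjMomKS G' X' x := by
  rw [adjMomKS, adjMomKS, covDAt_congr_of_eventuallyEq₂ hG hX, divAt_congr_of_eventuallyEq₂ hG hX,
    hG.eq_of_nhds]

/-- **`DM*ˢ_γ(X)` is local.** [cite: ChruscielDelay2003, §2] -/
theorem adjMomGS_congr_of_eventuallyEq (hG : G =ᶠ[𝓝 x] G') (hK : K =ᶠ[𝓝 x] K')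
    (hX : X =ᶠ[𝓝 x] X') : adjMomGS G K X x = adjMomGS G' K' X' x := by
  have hZ : (fun y ↦ sharpAt G y (K y (X y))) =ᶠ[𝓝 x] fun y ↦ sharpAt G' y (K' y (X' y)) := by
    filter_upwards [hG, hK, hX] with y hGy hKy hXy
    rw [sharpAt, sharpAt, hGy, hKy, hXy]
  rw [adjMomGS, adjMomGS, covDAt_congr_of_eventuallyEq₂ hG hX, cov₂At_congr_of_eventuallyEq hG hK,
    divAt_congr_of_eventuallyEq₂ hG hZ, divAt_congr_of_eventuallyEq₂ hG hX, hG.eq_of_nhds,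
    hK.eq_of_nhds, hX.eq_of_nhds]

end MetricCoord

end Literature.Geometry.Lorentzian

end
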